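import Summits.QuantumFields.YangMills.Theorems.LuscherReductionDressedRitzPolyakovLiftStaticsPositivity
import Summits.QuantumFields.YangMills.Theorems.FemtoTransferGapStrictPositivity
import Summits.QuantumFields.YangMills.Theorems.FemtoTransferGapSlabRayleigh
import HarnessLib

/-!
# Line «polyakovlift» on crux `DressedRitz` (stmt-QuantumFields-20205), stub S-STAT: clause (o0) survives TIME-DRESSING —
# `K_β` is injective on physical vectors, so `K_β^m u_i ≠ 0` for every lifted channel vector and every `m`

Fleet-service module of seat ym-infvol-p1 g5 (route `LuscherReduction`, femto rung R2b1).  The lead of the line (ym-lead-20205-polyakovlift g0,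
`HAZARD-S-LEAK-UV.md` 7ee9b1dd9d950070, 2026-08-27T11:44Z) prepares reshape r3 in which the lifted channel vectors are TIME-DRESSED by the item's
own transfer operator: `u_i' = K_β^m u_i`, `u_i = OpPlat.ins φ (flowLiftAt 0 t g_i)`, `m ≍ L` (equivalently, in the `OpPlat` format,
`u_i' = OpPlat.ins φ O_i'` with `O_i' = K_β^m(u_i)/φ`).  The lead noted: «only infvol-p1's `liftFamily_o0` needs a dressed twin; (o0) for the dressed
family needs `K_β` injective on physical vectors — tree `FemtoTransferGapStrictPositivity`».  This file supplies exactly that, format-agnostic: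

* §1 `l2_transferApply_self_pos` — **`K_β` is injective on physical `L²`-non-null vectors** (`β > 0`): `0 < ‖ψ‖² ⟹ 0 < ‖K_βψ‖²`, from Lüscher's
  strict positivity `0 < ⟨ψ, K_βψ⟩` (`qform_su2Rep_pos`) and Cauchy–Schwarz in `L²` (`PhysL2.inner_toL2`); `l2_iterate_transferApply_self_pos` — the
  same for every power `K_β^m`;
* §2 ★ `l2_iterate_ins_flowLiftAt_self_pos` — clause (o0) for the DRESSED lifted channel vector `K_β^m (OpPlat.ins φ (flowLiftAt x₀ t g))` of any
  one-site eigen-ratio `g`, every `m`, every flow time, every base point, every raw vacuum, every `B > 0`, every `β > 0` (undressed case =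
  `l2_ins_flowLiftAt_self_pos`, any real `β`); `liftBasis_dressed_o0` — packaged over a lift basis;
* §3 `ins_iterate_ins_div_eq` — the lead's `OpPlat` format IS the dressed vector: `OpPlat.ins φ (K_β^m(ins φ O)/φ) = K_β^m (ins φ O)` for a raw
  vacuum `φ` (nowhere zero, `rawVacuum_ne_zero`; `⟨φ, K_β^m u⟩ = λ₀^m⟨φ, u⟩ = 0` by symmetry of `K_β` and `OpPlat.l2_vac_ins`), so §2 applies verbatim
  to `OpPlat.ins φ O_i'`: `liftBasis_dressedIns_o0`.

HONEST FRAMING: fixed-lattice functional analysis on the CONDITIONAL femto rung R2b1; clause (o0) only (for any dressing depth); the RG content of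
the line is untouched; nothing here bears on infinite volume, the continuum limit or the Clay gap.  References: M. Lüscher, CMP 54 (1977) 283, §3
(strict positivity of the transfer matrix) [cite: Luscher1977, §3]; Reed–Simon IV [cite: ReedSimonIV1978, Thm XIII.43–44].
-/

set_option autoImplicit false

noncomputable section

open MeasureTheory Filter Topology
open scoped InnerProductSpace
open Literature.MathematicalPhysics.QuantumFieldTheory
open Literature.MathematicalPhysics.QuantumLattice
open scoped BigOperators

namespace Summit.QuantumFields.YangMills.Theorems.FemtoTransferGap.PolyakovLift

open Summit.QuantumFields.YangMills.Theorems.FemtoTransferGap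
open Summit.QuantumFields.YangMills.Theorems.FemtoTransferGap.PhysL2

/-! ## §1 `K_β` is injective on physical vectors (`β > 0`) -/

section Injective

variable {L : ℕ} [NeZero L]

/-- **`0 < ‖ψ‖² ⟹ 0 < ‖K_β ψ‖²`** for physical `ψ` and `β > 0`: Lüscher's strict positivity gives `0 < ⟨ψ, K_βψ⟩`, and
`⟨ψ, K_βψ⟩ ≤ ‖ψ‖·‖K_βψ‖` in `L²`. [cite: Luscher1977, §3] -/
theorem l2_transferApply_self_pos {β : ℝ} (hβ : 0 < β) {ψ : GaugeConfig 3 L SU2 → ℝ} (hψ : IsPhys ψ) (hpos : 0 < l2 ψ ψ) :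
    0 < l2 (transferApply β ψ) (transferApply β ψ) := by
  have hq : 0 < qform su2Rep β ψ ψ := qform_su2Rep_pos hβ hψ hpos
  rw [qform_eq_l2_transferApply] at hq
  have hK : IsPhys (transferApply (L := L) β ψ) := isPhys_transferApply β hψ
  set Ψ : physSubmodule L := ⟨ψ, hψ⟩ with hΨ
  set KΨ : physSubmodule L := ⟨transferApply β ψ, hK⟩ with hKΨ
  have hinner : l2 ψ (transferApply β ψ) = ⟪toL2 Ψ, toL2 KΨ⟫_ℝ := (inner_toL2 Ψ KΨ).symm
  have hnorm : l2 (transferApply β ψ) (transferApply β ψ) = ‖toL2 KΨ‖ ^ 2 := (norm_sq_toL2 KΨ).symm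
  rw [hnorm]
  by_contra hle
  push Not at hle
  have h0 : ‖toL2 KΨ‖ = 0 := by nlinarith [norm_nonneg (toL2 KΨ)]
  have hcs : l2 ψ (transferApply β ψ) ≤ ‖toL2 Ψ‖ * ‖toL2 KΨ‖ := by rw [hinner]; exact real_inner_le_norm _ _
  rw [h0, mul_zero] at hcs
  exact absurd hcs (not_le.mpr hq)

/-- **`0 < ‖ψ‖² ⟹ 0 < ‖K_β^m ψ‖²`** for every `m` (`β > 0`, `ψ` physical). [cite: Luscher1977, §3] -/
theorem l2_iterate_transferApply_self_pos {β : ℝ} (hβ : 0 < β) {ψ : GaugeConfig 3 L SU2 → ℝ} (hψ : IsPhys ψ) (hpos : 0 < l2 ψ ψ) :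
    ∀ m : ℕ, 0 < l2 ((transferApply (L := L) β)^[m] ψ) ((transferApply β)^[m] ψ)
  | 0 => by simpa using hpos
  | m + 1 => by
    rw [Function.iterate_succ_apply']
    exact l2_transferApply_self_pos hβ (isPhys_iterate_transferApply β hψ m) (l2_iterate_transferApply_self_pos hβ hψ hpos m)

end Injective

/-! ## §2 ★ Clause (o0) for time-dressed lifted channel vectors -/

section Dressed

variable {L : ℕ} [NeZero L]

/-- ★ **(o0), DRESSED**: for `β > 0`, a raw vacuum `φ`, a one-site coupling `B > 0`, a uniformly positive exact one-site ground state `ω` and a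
physical one-site `g` with `g·ω` an exact excited eigenfunction of unit norm, the time-dressed lifted channel vector
`K_β^m (OpPlat.ins φ (flowLiftAt x₀ t g))` has `0 < ‖·‖²` — every `m`, `t`, `x₀` (undressed `m = 0`: `l2_ins_flowLiftAt_self_pos`; then `K_β` is
injective on physical vectors). [cite: Luscher1977, §3] [cite: Luscher2010, §2] -/
theorem l2_iterate_ins_flowLiftAt_self_pos {β : ℝ} (hβ : 0 < β) {φ : GaugeConfig 3 L SU2 → ℝ} (hφ : IsPhys φ) (hφ1 : l2 φ φ = 1)
    (heig : transferApply β φ = levelValue su2Rep L β 0 • φ) {B : ℝ} (hB : 0 < B) {ω g : GaugeConfig 3 1 SU2 → ℝ}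
    (hω : IsPhys ω) (hωpos : ∃ c : ℝ, 0 < c ∧ ∀ V, c ≤ ω V) (hKω : transferApply B ω = levelValue su2Rep 1 B 0 • ω)
    (hg : IsPhys g) {j : ℕ} (hKg : transferApply B (g * ω) = levelValue su2Rep 1 B (j + 1) • (g * ω))
    (hn : l2 (g * ω) (g * ω) = 1) (x₀ : Site 3 L) (t : ℝ) (m : ℕ) :
    0 < l2 ((transferApply β)^[m] (OpPlat.ins φ (flowLiftAt x₀ t g))) ((transferApply β)^[m] (OpPlat.ins φ (flowLiftAt x₀ t g))) :=
  l2_iterate_transferApply_self_pos hβ (OpPlat.isPhys_ins hφ (isPhys_flowLiftAt x₀ t hg))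
    (l2_ins_flowLiftAt_self_pos β hφ hφ1 heig hB hω hωpos hKω hg hKg hn x₀ t) m

/-- ★ **(o0), DRESSED, for EVERY lift basis**: with `β > 0`, `IsRawVacuum β φ`, `LiftBasis B k ω g`, every channel `i`, every dressing depth `m`,
flow time `t`, base point `x₀`: `0 < ‖K_β^m (OpPlat.ins φ (flowLiftAt x₀ t g_i))‖²`. [cite: Luscher1977, §3] [cite: Luscher2010, §2] -/
theorem liftBasis_dressed_o0 {β : ℝ} (hβ : 0 < β) {φ : GaugeConfig 3 L SU2 → ℝ} (hvac : IsRawVacuum β φ)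
    {B : ℝ} (hB : 0 < B) {k : ℕ} {ω : GaugeConfig 3 1 SU2 → ℝ} {g : Fin k → (GaugeConfig 3 1 SU2 → ℝ)}
    (hbasis : LiftBasis B k ω g) (x₀ : Site 3 L) (t : ℝ) (m : ℕ) :
    ∀ i : Fin k, 0 < l2 ((transferApply β)^[m] (OpPlat.ins φ (flowLiftAt x₀ t (g i))))
      ((transferApply β)^[m] (OpPlat.ins φ (flowLiftAt x₀ t (g i)))) := by
  obtain ⟨hφ, hφ1, heig⟩ := hvac
  obtain ⟨hω, hωpos, -, hKω, hg, ⟨σ, hσ⟩, hon⟩ := hbasis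
  intro i
  have hn : l2 (g i * ω) (g i * ω) = 1 := by rw [hon i i, if_pos rfl]
  exact l2_iterate_ins_flowLiftAt_self_pos hβ hφ hφ1 heig hB hω hωpos hKω (hg i) (hσ i) hn x₀ t m

end Dressed

/-! ## §3 The lead's `OpPlat` format of the dressed vector: `OpPlat.ins φ (K_β^m(ins φ O)/φ) = K_β^m (ins φ O)` -/

section Format

variable {L : ℕ} [NeZero L]

/-- `⟨φ, K_β^m u⟩ = λ₀^m ⟨φ, u⟩` for a raw vacuum `φ` and a physical `u` (symmetry of `K_β`, `K_βφ = λ₀φ`, induction). [folklore] -/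
theorem l2_vac_iterate_transferApply (β : ℝ) {φ : GaugeConfig 3 L SU2 → ℝ} (hφ : IsPhys φ)
    (heig : transferApply β φ = levelValue su2Rep L β 0 • φ) {u : GaugeConfig 3 L SU2 → ℝ} (hu : IsPhys u) :
    ∀ m : ℕ, l2 φ ((transferApply β)^[m] u) = levelValue su2Rep L β 0 ^ m * l2 φ u
  | 0 => by simp
  | m + 1 => by
    rw [Function.iterate_succ_apply', ← l2_transferApply_comm β hφ (isPhys_iterate_transferApply β hu m), heig, l2_smul_left,
      l2_vac_iterate_transferApply β hφ heig hu m, pow_succ]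
    ring

/-- **The `OpPlat` format of time-dressing IS `K_β^m`**: for a raw vacuum `φ` (physical, `‖φ‖² = 1`, `K_βφ = λ₀φ`; nowhere zero by
`rawVacuum_ne_zero`) and a physical insertion `O`, `OpPlat.ins φ (K_β^m(OpPlat.ins φ O)/φ) = K_β^m (OpPlat.ins φ O)` — the subtracted constant
`⟨φ, K_β^m u⟩ = λ₀^m⟨φ, u⟩` vanishes (`OpPlat.l2_vac_ins`). [cite: LuscherWolff1990] -/
theorem ins_iterate_ins_div_eq (β : ℝ) {φ : GaugeConfig 3 L SU2 → ℝ} (hφ : IsPhys φ) (hφ1 : l2 φ φ = 1)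
    (heig : transferApply β φ = levelValue su2Rep L β 0 • φ) {O : GaugeConfig 3 L SU2 → ℝ} (hO : IsPhys O) (m : ℕ) :
    OpPlat.ins φ ((transferApply β)^[m] (OpPlat.ins φ O) / φ) = (transferApply β)^[m] (OpPlat.ins φ O) := by
  have hne : ∀ U, φ U ≠ 0 := rawVacuum_ne_zero β hφ hφ1 heig
  rw [OpPlat.ins_div hne, l2_vac_iterate_transferApply β hφ heig (OpPlat.isPhys_ins hφ hO) m, OpPlat.l2_vac_ins hφ hO hφ1,
    mul_zero, zero_smul, sub_zero]

/-- The lead's dressed insertion `O' = K_β^m(ins φ O)/φ` is physical (raw vacuum `φ = ±Ω`, `|φ| ≥ c > 0`: `exists_pos_le_abs_rawVacuum`; then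
`OpPlat.isPhys_div` on `|φ|`-sign-corrected quotient). Stated through `ins`: the vector `OpPlat.ins φ O'` is physical. [folklore] -/
theorem isPhys_ins_iterate_ins_div (β : ℝ) {φ : GaugeConfig 3 L SU2 → ℝ} (hφ : IsPhys φ) (hφ1 : l2 φ φ = 1)
    (heig : transferApply β φ = levelValue su2Rep L β 0 • φ) {O : GaugeConfig 3 L SU2 → ℝ} (hO : IsPhys O) (m : ℕ) :
    IsPhys (OpPlat.ins φ ((transferApply β)^[m] (OpPlat.ins φ O) / φ)) := by
  rw [ins_iterate_ins_div_eq β hφ hφ1 heig hO m]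
  exact isPhys_iterate_transferApply β (OpPlat.isPhys_ins hφ hO) m

/-- ★ **(o0) in the lead's `OpPlat` format, for EVERY lift basis**: with `β > 0`, `IsRawVacuum β φ`, `LiftBasis B k ω g`, the dressed insertions
`O_i' = K_β^m(OpPlat.ins φ (flowLiftAt x₀ t g_i))/φ` give channel vectors `OpPlat.ins φ O_i'` of positive norm — every `i`, `m`, `t`, `x₀`.
[cite: Luscher1977, §3] [cite: Luscher2010, §2] -/
theorem liftBasis_dressedIns_o0 {β : ℝ} (hβ : 0 < β) {φ : GaugeConfig 3 L SU2 → ℝ} (hvac : IsRawVacuum β φ)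
    {B : ℝ} (hB : 0 < B) {k : ℕ} {ω : GaugeConfig 3 1 SU2 → ℝ} {g : Fin k → (GaugeConfig 3 1 SU2 → ℝ)}
    (hbasis : LiftBasis B k ω g) (x₀ : Site 3 L) (t : ℝ) (m : ℕ) :
    ∀ i : Fin k,
      0 < l2 (OpPlat.ins φ ((transferApply β)^[m] (OpPlat.ins φ (flowLiftAt x₀ t (g i))) / φ))
        (OpPlat.ins φ ((transferApply β)^[m] (OpPlat.ins φ (flowLiftAt x₀ t (g i))) / φ)) := by
  intro i
  have hg : IsPhys (g i) := hbasis.2.2.2.2.1 i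
  rw [ins_iterate_ins_div_eq β hvac.1 hvac.2.1 hvac.2.2 (isPhys_flowLiftAt x₀ t hg) m]
  exact liftBasis_dressed_o0 hβ hvac hB hbasis x₀ t m i

end Format

end Summit.QuantumFields.YangMills.Theorems.FemtoTransferGap.PolyakovLift

end
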